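import Summits.QuantumAdvantage.QuantumAdvantage.Theorems.SteerDialAffine
import Summits.QuantumAdvantage.QuantumAdvantage.Theorems.RingDeck

/-!
# SteerDial (14): SteerDialState — the covering dichotomy DECIDED on arbitrary STATE TESTS

Part 14 of the prover-side twin of the lineage decomp-qadv-lens-5 steering programme, generation 9, workshop node
«TagDial» rev 6 §11.  The strategy-free dichotomy `InvModCover3` (part 11) — FALSE without the invariant factor
(critic's certificate / class-weight tests), PROVED on affine systems (part 13) — is here PROVED on the family of
STATE TESTS `ψ := [st(x|_{[0,n)}) ∉ M]`: `st(y) ∈ 𝔽₃^D` = the values of `D ≤ (log₂ n)^c` linear forms `v_k` over `𝔽₃`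
whose span is closed under the cyclic shift (witness matrix `A`), `M ⊆ 𝔽₃^D` ARBITRARY — i.e. every Boolean / `𝔽₃`
combination of the periodic class-weight statistics (periods `≤ polylog`; the refuting tests of the schedule-only
statement are the case `M = {0}`): `steerDial_invModCover3State`.
Mechanism (no linear algebra): `rcnt E y = #{s < n : rot^s y ∈ E}` is rotation-invariant (`rcnt_rot`); heavy strings
(`64·rcnt ≥ n`) number `≤ 64·#E` (`card_heavy_le`, double counting); averaging over all `n^T` rotation lists gives a
list with `64^T · #{light y : all listed rotations in E} ≤ 2ⁿ` (`exists_rotList`); for a state test `heavy` is a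
function of the state (`stv_rot_det`, `rcnt_congr_of_stv`), so `φ := 1 − 1_heavy` is a polynomial of degree `≤ 2D`
(`phiSt_mem_lowDeg`), rotation-invariant and `(1 − 64·#E/2ⁿ)`-dense; `T := k'(log₂ n + 1)`.
No `def … : Prop`, no `instance`, no `notation`.
-/

set_option linter.style.longLine false
set_option linter.dupNamespace false

namespace Summit.QuantumAdvantage.QuantumAdvantage.Theorems.SteerDial

open Finset
open Literature.Computability.QuantumComplexity Literature.Computability.MetaComplexity
open Literature.Computability.QuantumComplexity.RingHLF
open Summit.QuantumAdvantage.AdviceFreeQNC0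
open Summit.QuantumAdvantage.QuantumAdvantage.Theses

/-! ## STATE TESTS: random rotation lists + Markov for ARBITRARY predicates of a rotation-closed family of polylog many
linear forms (workshop node «TagDial» rev 6 §11)

Family: `ψ(x) := [st(x|_{[0,n)}) ∉ M]` where `st(y) = (ℓ_{v_k}(y))_{k<D} ∈ 𝔽₃^D` is the STATE of the body under
`D ≤ (log₂ n)^c` linear forms `v_k` over `𝔽₃` whose span is CLOSED UNDER THE CYCLIC SHIFT (witness matrix `A`:
`σ v_k = Σ_{k'} A k k' v_{k'}`), and `M ⊆ 𝔽₃^D` is an ARBITRARY (non-linear!) set of rejected states.  Contains every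
Boolean / `𝔽₃` combination of the periodic class-weight statistics `L_j` (periods `a ≤ polylog`, in particular the
refuter `ψ_B` of `AdaptiveNoSat3`, §8) and of the weight residue mod 3; degree `≤ 2D` automatically.
Mechanism (different from §10: RANDOM ROTATION LISTS + MARKOV, no linear algebra): `rcnt E y := #{s < n : rot^s y ∈ E}`
is rotation-invariant; `heavy y :⟺ 64·rcnt ≥ n`; (a) `#heavy ≤ 64·#E` (double counting, `card_heavy_le`);
(b) averaging over all lists `r ∈ [0,n)^T`: `Σ_r #{y light, ∀ t, rot^{r_t} y ∈ E} = Σ_{y light} rcnt(y)^T ≤ 2ⁿ(n/64)^T`,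
so some list has `64^T·#Bad_light ≤ 2ⁿ` (`exists_rotList`); (c) for a state test, `heavy` is a function of the state
(`st(rot y)` is determined by `st(y)`), hence `φ := 1 − 1_heavy` is a polynomial of degree `≤ 2D` in `y`
(`phiSt_mem_lowDeg`), rotation-invariant, `(1 − 64·#E/2ⁿ)`-dense.  Assembly: `invModCover3_stateCore`,
`steerDial_invModCover3State` (`η := η_I/4096`, `m := 6`, words `W0`, `c₁ := 2`, `c' := c + 1`). -/

section RotCount

variable {n : ℕ}

/-- Number of rotations `s < n` with `rot^s y ∈ E`. -/
def rcnt (E : Finset (Fin n → Bool)) (y : Fin n → Bool) : ℕ :=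
  (univ.filter fun s : Fin n => rot s.val y ∈ E).card

/-- `rcnt` as a sum of indicators over `s < n`. -/
theorem rcnt_eq_sum (E : Finset (Fin n → Bool)) (y : Fin n → Bool) :
    rcnt E y = ∑ s ∈ Finset.range n, (if rot s y ∈ E then 1 else 0) := by
  classical
  unfold rcnt
  rw [Finset.card_filter]
  exact Fin.sum_univ_eq_sum_range (fun s => if rot s y ∈ E then 1 else 0) n

/-- `rcnt` is rotation-invariant. -/
theorem rcnt_rot (E : Finset (Fin n → Bool)) (y : Fin n → Bool) : rcnt E (rot 1 y) = rcnt E y := by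
  classical
  rw [rcnt_eq_sum, rcnt_eq_sum]
  have h1 : ∀ t, rot t (rot 1 y) = rot (t + 1) y := fun t => RingSymmetry.rot_rot t 1 y
  simp_rw [h1]
  have key := Finset.sum_range_succ' (fun t => if rot t y ∈ E then (1 : ℕ) else 0) n
  have key2 := Finset.sum_range_succ (fun t => if rot t y ∈ E then (1 : ℕ) else 0) n
  beta_reduce at key key2
  have hf : (if rot n y ∈ E then (1 : ℕ) else 0) = (if rot 0 y ∈ E then 1 else 0) := by
    rw [Summit.QuantumAdvantage.QuantumAdvantage.Theorems.RingMinor.rot_n, RingSymmetry.rot_zero]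
  omega

/-- (a) MARKOV: the heavy strings (`64·rcnt ≥ n`) number at most `64·#E`. -/
theorem card_heavy_le (hn : 0 < n) (E : Finset (Fin n → Bool)) :
    (univ.filter fun y : Fin n → Bool => n ≤ 64 * rcnt E y).card ≤ 64 * E.card := by
  classical
  set H := univ.filter fun y : Fin n → Bool => n ≤ 64 * rcnt E y with hH
  have h1 : H.card * n ≤ ∑ y ∈ H, 64 * rcnt E y := by
    rw [← smul_eq_mul, ← Finset.sum_const]
    exact Finset.sum_le_sum fun y hy => (Finset.mem_filter.mp hy).2
  have h2 : ∑ y ∈ H, 64 * rcnt E y ≤ ∑ y, 64 * rcnt E y :=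
    Finset.sum_le_sum_of_subset_of_nonneg (Finset.subset_univ H) fun _ _ _ => Nat.zero_le _
  have h3 : ∑ y : Fin n → Bool, rcnt E y ≤ n * E.card := by
    have e : ∑ y : Fin n → Bool, rcnt E y =
        ∑ s : Fin n, (univ.filter fun y : Fin n → Bool => rot s.val y ∈ E).card := by
      unfold rcnt
      simp_rw [Finset.card_filter]
      exact Finset.sum_comm
    rw [e]
    have hs : ∀ s : Fin n, (univ.filter fun y : Fin n → Bool => rot s.val y ∈ E).card = E.card := by
      intro s
      rw [RingSymmetry.card_filter_comp_of_bijective (rot s.val) (RingSymmetry.rot_bijective s.val) (fun y => y ∈ E)]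
      rw [Finset.filter_mem_eq_inter, Finset.univ_inter]
    simp_rw [hs]
    rw [Finset.sum_const, Finset.card_univ, Fintype.card_fin, smul_eq_mul]
  have h4 : H.card * n ≤ 64 * E.card * n :=
    calc H.card * n ≤ ∑ y, 64 * rcnt E y := h1.trans h2
      _ = 64 * ∑ y, rcnt E y := by rw [Finset.mul_sum]
      _ ≤ 64 * (n * E.card) := Nat.mul_le_mul_left _ h3
      _ = 64 * E.card * n := by ring
  exact Nat.le_of_mul_le_mul_right h4 hn

/-- (b) RANDOM LISTS: some rotation list of length `T` leaves at most `2ⁿ/64^T` light strings all of whose listed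
rotations lie in `E` (averaging over all `n^T` lists). -/
theorem exists_rotList (hn : 0 < n) (E : Finset (Fin n → Bool)) (T : ℕ) :
    ∃ r : Fin T → ℕ, 64 ^ T * (univ.filter fun y : Fin n → Bool =>
        ¬ n ≤ 64 * rcnt E y ∧ ∀ t, rot (r t) y ∈ E).card ≤ 2 ^ n := by
  classical
  set cnt : (Fin T → Fin n) → ℕ := fun r =>
    (univ.filter fun y : Fin n → Bool => ¬ n ≤ 64 * rcnt E y ∧ ∀ t, rot (r t).val y ∈ E).card with hcnt
  have hswap : ∑ r, cnt r =
      ∑ y ∈ univ.filter (fun y : Fin n → Bool => ¬ n ≤ 64 * rcnt E y), rcnt E y ^ T := by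
    simp only [hcnt, Finset.card_filter]
    rw [Finset.sum_comm, Finset.sum_filter]
    refine Finset.sum_congr rfl fun y _ => ?_
    by_cases hl : n ≤ 64 * rcnt E y
    · simp only [hl, not_true_eq_false, false_and, if_false, Finset.sum_const_zero]
    · simp only [hl, not_false_eq_true, true_and, if_true]
      rw [← Finset.card_filter]
      have e : (univ.filter fun r : Fin T → Fin n => ∀ t, rot (r t).val y ∈ E) =
          Fintype.piFinset fun _ : Fin T => univ.filter fun s : Fin n => rot s.val y ∈ E := by
        ext r
        simp [Fintype.mem_piFinset]
      rw [e, Fintype.card_piFinset, Finset.prod_const, Finset.card_univ, Fintype.card_fin]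
      rfl
  have hbound : 64 ^ T * ∑ r, cnt r ≤ n ^ T * 2 ^ n := by
    rw [hswap, Finset.mul_sum]
    calc ∑ y ∈ univ.filter (fun y : Fin n → Bool => ¬ n ≤ 64 * rcnt E y), 64 ^ T * rcnt E y ^ T
        ≤ ∑ y ∈ univ.filter (fun y : Fin n → Bool => ¬ n ≤ 64 * rcnt E y), n ^ T :=
          Finset.sum_le_sum fun y hy => by
            have hl := (Finset.mem_filter.mp hy).2
            rw [← mul_pow]
            exact Nat.pow_le_pow_left (by omega) T
      _ ≤ ∑ y : Fin n → Bool, n ^ T :=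
          Finset.sum_le_sum_of_subset_of_nonneg (Finset.subset_univ _) fun _ _ _ => Nat.zero_le _
      _ = n ^ T * 2 ^ n := by
          rw [Finset.sum_const, Finset.card_univ, Fintype.card_fun, Fintype.card_bool, Fintype.card_fin,
            smul_eq_mul, mul_comm]
  have hne : (univ : Finset (Fin T → Fin n)).Nonempty := ⟨fun _ => ⟨0, hn⟩, mem_univ _⟩
  have hsum : ∑ r ∈ (univ : Finset (Fin T → Fin n)), 64 ^ T * cnt r ≤
      ∑ r ∈ (univ : Finset (Fin T → Fin n)), 2 ^ n := by
    rw [← Finset.mul_sum, Finset.sum_const, Finset.card_univ, Fintype.card_fun, Fintype.card_fin,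
      Fintype.card_fin, smul_eq_mul]
    exact hbound
  obtain ⟨r, _, hr⟩ := Finset.exists_le_of_sum_le hne hsum
  exact ⟨fun t => (r t).val, hr⟩

end RotCount


end Summit.QuantumAdvantage.QuantumAdvantage.Theorems.SteerDial
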